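import Summits.FinalStateConjecture.FinalStateConjecture.Theorems.BartnikGapSettlingGapExhaustionDocLocalisation
import HarnessLib

/-!
# Crux `GapExhaustion` (stmt-FinalStateConjecture-10808), line `photon-shell-pseudoconvexity`:
# stub (UD-of) `docLocalisation_of_escapeFields` — ESCAPE with the escape fields as INPUT: the
# band `{r₊ + η ≤ r ≤ R}` of every chart `C¹`-close to Kerr, within the EXPLICIT tolerance
# `min 1 (m / (2 L²))` of the escape-field constants, lies in the chronological past of the far
# zone `{r > R}`, whatever the time orientation of the ambient spacetime (§1f of the line; lead
# c11, label-uniformity wave 1)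

Route `BartnikGapSettling`; helper (`--supports stmt-FinalStateConjecture-10808`). This is the
"escape fields as input" refactor of the per-label localisation `stub_docLocalisation` of
`…DocLocalisation.lean`: there the tolerance `δ` is produced existentially from the escape-field
brick (E-1b) `stub_kerrEscapeFieldsContinuous`; the label-uniform sweep S5 needs to know that `δ`
depends on the escape-field data `(m, L)` ONLY, through `δ = min 1 (m / (2 L²))`, and not on the
label `(M, a)` otherwise. So here the two escape fields `Y₁, Y₂` (continuous on `{r > r₊}`,
`‖Yᵢ‖ ≤ L`, `g(Yᵢ, Yᵢ) ≤ −m`, `g(Y₁, Y₂) ≥ m`, `dr(Yᵢ) ≥ ν` on the band `r₊ + η ≤ r ≤ R + 2`) are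
HYPOTHESES, and the conclusion is stated with the tolerance written out. The band-regularity
constants of (E-6) `stub_kerrBandRegularity` enter the segment length `s₀` of the chain but not
the tolerance. Proof = the proof of `stub_docLocalisation` from its second line on: segments
`stub_escapeSegment`, chain `stub_escapeChain`, and the dichotomy "one of `dΦ Y₁, dΦ Y₂` is
future-directed" at the starting point. O'Neill 1983, Ch. 14 (chronological relations, time
duality); Dafermos–Rodnianski arXiv:0811.0354 §5.1 (`−g♯dt*` timelike).
-/

noncomputable section

-- the segment lemma's 40-odd-argument applications need the deeper pending-instance search
set_option maxSynthPendingDepth 3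

-- D-0017: single-problem summit, `Summit.<S>.<S>.…` by design (cf. lakefile `weak.linter.dupNamespace`).
set_option linter.dupNamespace false

namespace Summit.FinalStateConjecture.FinalStateConjecture.Theorems

open Set Metric Function
open Literature.Geometry.Lorentzian
open scoped Manifold ContDiff Topology

/-- **Stub (UD-of) of the line `photon-shell-pseudoconvexity` (crux `GapExhaustion`,
stmt-FinalStateConjecture-10808) — localisation of the domain of outer communications in a
near-Kerr chart, orientation-free, with the escape fields as input. [folklore]** Let `0 < M`,
`|a| < M`, `0 < η`, `r₊ + η ≤ R`, `m, ν, L > 0`, and let `Y₁, Y₂ : E4 → E4` be continuous on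
`{r > r₊}` with `‖Yᵢ z‖ ≤ L`, `g_{M,a}(Yᵢ, Yᵢ) ≤ −m`, `g_{M,a}(Y₁, Y₂) ≥ m`, `dr(Yᵢ) ≥ ν` at every
`z` with `r₊ + η ≤ r(z) ≤ R + 2`. Then for every spacetime `𝓢` and every chart `Φ : E4 → 𝓢`, smooth
with injective differential on `{r > M}`, whose pulled-back components are
`min 1 (m / (2 L²))`-close to the Kerr–Schild form `g_{M,a}` in `C⁰` and `C¹` on the band
`r₊ + η/2 ≤ r ≤ R + 2`, every point `z` with `r₊ + η ≤ r(z) ≤ R` satisfies `Φ z ∈ I⁻(Φ({r > R}))`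
for the time orientation of `𝓢`. Re-packaging of `stub_docLocalisation` (O'Neill 1983, Ch. 14;
Dafermos–Rodnianski arXiv:0811.0354, §5.1). -/
theorem docLocalisation_of_escapeFields :
    ∀ (M a η R m ν L : ℝ) (Y₁ Y₂ : E4 → E4), 0 < M → |a| < M → 0 < η → Kerr.rPlus M a + η ≤ R →
      0 < m → 0 < ν → 0 < L →
      ContinuousOn Y₁ {z : E4 | Kerr.rPlus M a < Kerr.radius a z} →
      ContinuousOn Y₂ {z : E4 | Kerr.rPlus M a < Kerr.radius a z} →
      (∀ z : E4, Kerr.rPlus M a + η ≤ Kerr.radius a z → Kerr.radius a z ≤ R + 2 →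
          ‖Y₁ z‖ ≤ L ∧ ‖Y₂ z‖ ≤ L ∧
          Kerr.bilin M a z (Y₁ z) (Y₁ z) ≤ -m ∧ Kerr.bilin M a z (Y₂ z) (Y₂ z) ≤ -m ∧
          m ≤ Kerr.bilin M a z (Y₁ z) (Y₂ z) ∧
          ν ≤ fderiv ℝ (Kerr.radius a) z (Y₁ z) ∧ ν ≤ fderiv ℝ (Kerr.radius a) z (Y₂ z)) →
      ∀ (𝓢 : Spacetime.{0} 4) (Φ : E4 → 𝓢.carrier),
        ContMDiffOn 𝓘(ℝ, E4) (𝓡 4) ∞ Φ {z | M < Kerr.radius a z} →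
        (∀ z : E4, M < Kerr.radius a z → Function.Injective (mfderiv 𝓘(ℝ, E4) (𝓡 4) Φ z)) →
        (∀ z : E4, Kerr.rPlus M a + η / 2 ≤ Kerr.radius a z → Kerr.radius a z ≤ R + 2 →
          ‖𝓢.metricInCoords Φ z - Kerr.bilin M a z‖ ≤ min 1 (m / (2 * L ^ 2)) ∧
          ‖fderiv ℝ (𝓢.metricInCoords Φ) z - fderiv ℝ (Kerr.bilin M a) z‖ ≤
            min 1 (m / (2 * L ^ 2))) →
        ∀ z : E4, Kerr.rPlus M a + η ≤ Kerr.radius a z → Kerr.radius a z ≤ R →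
          Φ z ∈ 𝓢.metric.chronologicalPast 𝓢.timeOrientation (Φ '' {y | R < Kerr.radius a y}) := by
  intro M a η R m ν L Y₁ Y₂ hM _ha hη hR hm hν hL hY₁c hY₂c hY 𝓢 Φ hΦ hinj hclose z hzlo hzR
  have hrpM : M ≤ Kerr.rPlus M a := le_add_of_nonneg_right (Real.sqrt_nonneg _)
  -- (E-6) tube constants on `[r₊ + η, R + 1]`
  obtain ⟨ρ₀, L₁, L₂, L₃, B₀, hρ₀, hL₁, hL₂, hL₃, hB₀, hreg⟩ :=
    stub_kerrBandRegularity M a (Kerr.rPlus M a + η) (R + 1) (by linarith) (by linarith)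
  -- the tolerance
  set δ : ℝ := min 1 (m / (2 * L ^ 2)) with hδdef
  have hδ : 0 < δ := lt_min one_pos (by positivity)
  have hδ1 : δ ≤ 1 := min_le_left _ _
  have hδm : δ * L ^ 2 ≤ m / 2 := by
    have h1 : δ ≤ m / (2 * L ^ 2) := min_le_right _ _
    have hL2 : 0 < L ^ 2 := by positivity
    calc δ * L ^ 2 ≤ m / (2 * L ^ 2) * L ^ 2 := mul_le_mul_of_nonneg_right h1 hL2.le
      _ = m / 2 := by field_simp
  -- the segment length
  set s₀ : ℝ := min (ρ₀ / L) (min (η / (2 * (L * (L₃ + 1)))) (min (1 / (L * (L₃ + 1)))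
    (min (m / 2 / 2 / ((L₁ + 1) * L ^ 3)) (ν / 2 / (L₂ * L ^ 2 + 1))))) with hs₀def
  have hs₀ : 0 < s₀ := by positivity
  have hs₀ρ : s₀ * L ≤ ρ₀ := by
    have h : s₀ ≤ ρ₀ / L := min_le_left _ _
    calc s₀ * L ≤ ρ₀ / L * L := mul_le_mul_of_nonneg_right h hL.le
      _ = ρ₀ := by field_simp
  have hs₀η : L₃ * (s₀ * L) ≤ η / 2 := by
    have h : s₀ ≤ η / (2 * (L * (L₃ + 1))) := (min_le_right _ _).trans (min_le_left _ _)
    have h' : s₀ * (L * (L₃ + 1)) ≤ η / 2 := by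
      calc s₀ * (L * (L₃ + 1)) ≤ η / (2 * (L * (L₃ + 1))) * (L * (L₃ + 1)) :=
            mul_le_mul_of_nonneg_right h (by positivity)
        _ = η / 2 := by field_simp
    nlinarith [mul_nonneg hs₀.le hL.le]
  have hs₀1 : L₃ * (s₀ * L) ≤ 1 := by
    have h : s₀ ≤ 1 / (L * (L₃ + 1)) :=
      (min_le_right _ _).trans ((min_le_right _ _).trans (min_le_left _ _))
    have h' : s₀ * (L * (L₃ + 1)) ≤ 1 := by
      calc s₀ * (L * (L₃ + 1)) ≤ 1 / (L * (L₃ + 1)) * (L * (L₃ + 1)) :=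
            mul_le_mul_of_nonneg_right h (by positivity)
        _ = 1 := by field_simp
    nlinarith [mul_nonneg hs₀.le hL.le]
  have hs₀m : s₀ * ((L₁ + 1) * L ^ 3) ≤ m / 2 / 2 := by
    have h : s₀ ≤ m / 2 / 2 / ((L₁ + 1) * L ^ 3) :=
      (min_le_right _ _).trans ((min_le_right _ _).trans ((min_le_right _ _).trans
        (min_le_left _ _)))
    calc s₀ * ((L₁ + 1) * L ^ 3) ≤ m / 2 / 2 / ((L₁ + 1) * L ^ 3) * ((L₁ + 1) * L ^ 3) :=
          mul_le_mul_of_nonneg_right h (by positivity)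
      _ = m / 2 / 2 := by field_simp
  have hs₀ν : s₀ * (L₂ * L ^ 2) ≤ ν / 2 := by
    have h : s₀ ≤ ν / 2 / (L₂ * L ^ 2 + 1) :=
      (min_le_right _ _).trans ((min_le_right _ _).trans ((min_le_right _ _).trans
        (min_le_right _ _)))
    calc s₀ * (L₂ * L ^ 2) ≤ s₀ * (L₂ * L ^ 2 + 1) :=
          mul_le_mul_of_nonneg_left (by linarith) hs₀.le
      _ ≤ ν / 2 / (L₂ * L ^ 2 + 1) * (L₂ * L ^ 2 + 1) :=
          mul_le_mul_of_nonneg_right h (by positivity)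
      _ = ν / 2 := by field_simp
  -- (E-6)'s first conclusion in the form the segment lemma wants
  have hreg' : ∀ z : E4, Kerr.rPlus M a + η ≤ Kerr.radius a z → Kerr.radius a z ≤ R + 1 →
      ∀ w : E4, ‖w‖ ≤ ρ₀ →
        (Kerr.rPlus M a + η) / 2 < Kerr.radius a (z + w) ∧
        |Kerr.radius a (z + w) - Kerr.radius a z| ≤ L₃ * ‖w‖ ∧
        ContDiffAt ℝ 2 (Kerr.bilin M a) (z + w) ∧ ContDiffAt ℝ 2 (Kerr.radius a) (z + w) ∧
        ‖Kerr.bilin M a (z + w)‖ ≤ B₀ ∧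
        ‖fderiv ℝ (Kerr.bilin M a) (z + w)‖ ≤ L₁ ∧
        ‖fderiv ℝ (Kerr.radius a) (z + w)‖ ≤ L₃ ∧
        ‖fderiv ℝ (fderiv ℝ (Kerr.radius a)) (z + w)‖ ≤ L₂ := hreg
  -- segment facts for both escape fields
  have hO : IsOpen {x : E4 | M < Kerr.radius a x} :=
    isOpen_lt continuous_const (Kerr.continuous_radius a)
  have hY₁ : ∀ x : E4, Kerr.rPlus M a + η ≤ Kerr.radius a x → Kerr.radius a x ≤ R + 2 →
      ‖Y₁ x‖ ≤ L ∧ Kerr.bilin M a x (Y₁ x) (Y₁ x) ≤ -m ∧ ν ≤ fderiv ℝ (Kerr.radius a) x (Y₁ x) :=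
    fun x h1 h2 ↦ ⟨(hY x h1 h2).1, (hY x h1 h2).2.2.1, (hY x h1 h2).2.2.2.2.2.1⟩
  have hY₂ : ∀ x : E4, Kerr.rPlus M a + η ≤ Kerr.radius a x → Kerr.radius a x ≤ R + 2 →
      ‖Y₂ x‖ ≤ L ∧ Kerr.bilin M a x (Y₂ x) (Y₂ x) ≤ -m ∧ ν ≤ fderiv ℝ (Kerr.radius a) x (Y₂ x) :=
    fun x h1 h2 ↦ ⟨(hY x h1 h2).2.1, (hY x h1 h2).2.2.2.1, (hY x h1 h2).2.2.2.2.2.2⟩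
  have hseg := fun (Y : E4 → E4) (hYb : ∀ x : E4, Kerr.rPlus M a + η ≤ Kerr.radius a x →
      Kerr.radius a x ≤ R + 2 →
      ‖Y x‖ ≤ L ∧ Kerr.bilin M a x (Y x) (Y x) ≤ -m ∧ ν ≤ fderiv ℝ (Kerr.radius a) x (Y x))
      (hYc : ContinuousOn Y {x | Kerr.rPlus M a < Kerr.radius a x})
      (x : E4) (hxlo : Kerr.rPlus M a + η ≤ Kerr.radius a x) (hxR : Kerr.radius a x ≤ R) ↦
    stub_escapeSegment 𝓢 Φ M a η R δ m ν L ρ₀ L₁ L₂ L₃ B₀ s₀ Y hη hm hν hL hL₁ hL₂ hL₃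
      hδ hδ1 hδm hs₀ hs₀ρ hs₀η hs₀1 hs₀m hs₀ν hΦ hreg' hclose hYb hYc x hxlo hxR
  -- the chain along a field `Y` which is future-directed at `z`
  have hchain : ∀ (Y : E4 → E4),
      (∀ x : E4, Kerr.rPlus M a + η ≤ Kerr.radius a x → Kerr.radius a x ≤ R + 2 →
        ‖Y x‖ ≤ L ∧ Kerr.bilin M a x (Y x) (Y x) ≤ -m ∧ ν ≤ fderiv ℝ (Kerr.radius a) x (Y x)) →
      ContinuousOn Y {x | Kerr.rPlus M a < Kerr.radius a x} →
      𝓢.timeOrientation.IsFutureDirected (mfderiv 𝓘(ℝ, E4) (𝓡 4) Φ z (Y z)) →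
      Φ z ∈ 𝓢.metric.chronologicalPast 𝓢.timeOrientation (Φ '' {y | R < Kerr.radius a y}) := by
    intro Y hYb hYc hfut
    have H := fun x hxlo hxR ↦ hseg Y hYb hYc x hxlo hxR
    -- number of segments
    set c : ℝ := ν / 2 with hcdef
    have hc : 0 < c := by positivity
    obtain ⟨n, hn⟩ : ∃ n : ℕ, R < Kerr.radius a z + n * (s₀ * c) := by
      refine ⟨⌊(R - Kerr.radius a z) / (s₀ * c)⌋₊ + 1, ?_⟩
      have h1 := Nat.lt_floor_add_one ((R - Kerr.radius a z) / (s₀ * c))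
      rw [div_lt_iff₀ (by positivity)] at h1
      push_cast
      linarith
    refine stub_escapeChain 𝓢 Φ {x | M < Kerr.radius a x} (Kerr.radius a) Y
      (Kerr.rPlus M a + η) R s₀ c hO hΦ (fun y hy ↦ hinj y hy) hs₀ hc
      (fun x hxlo hxR ↦ (H x hxlo hxR).1) (fun x hxlo hxR ↦ (H x hxlo hxR).2.1)
      (fun x hxlo hxR ↦ (H x hxlo hxR).2.2.1) (fun x hxlo hxR ↦ (H x hxlo hxR).2.2.2.1)
      (fun x hxlo hxR ↦ (H x hxlo hxR).2.2.2.2) n z hzlo hzR hn hfut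
  -- dichotomy at `z`: one of `dΦ Y₁`, `dΦ Y₂` is future-directed
  have hzR2 : Kerr.radius a z ≤ R + 2 := by linarith
  obtain ⟨hY₁L, hY₂L, hK11, hK22, hK12, -, -⟩ := hY z hzlo hzR2
  have hcl := (hclose z (by linarith) hzR2).1
  have happrox : ∀ u w : E4, ‖u‖ ≤ L → ‖w‖ ≤ L →
      |𝓢.metricInCoords Φ z u w - Kerr.bilin M a z u w| ≤ δ * L ^ 2 := by
    intro u w hu hw
    have h1 : |(𝓢.metricInCoords Φ z - Kerr.bilin M a z) u w| ≤
        ‖𝓢.metricInCoords Φ z - Kerr.bilin M a z‖ * ‖u‖ * ‖w‖ :=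
      (Real.norm_eq_abs _ ▸ (𝓢.metricInCoords Φ z - Kerr.bilin M a z).le_opNorm₂ u w)
    simp only [FunLike.coe_sub, Pi.sub_apply] at h1
    refine h1.trans ?_
    have : ‖𝓢.metricInCoords Φ z - Kerr.bilin M a z‖ * ‖u‖ * ‖w‖ ≤ δ * L * L :=
      mul_le_mul (mul_le_mul hcl hu (norm_nonneg _) hδ.le) hw (norm_nonneg _) (by positivity)
    nlinarith
  have hG11 : 𝓢.metricInCoords Φ z (Y₁ z) (Y₁ z) < 0 := by
    have := (abs_le.1 (happrox _ _ hY₁L hY₁L)).2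
    linarith
  have hG22 : 𝓢.metricInCoords Φ z (Y₂ z) (Y₂ z) < 0 := by
    have := (abs_le.1 (happrox _ _ hY₂L hY₂L)).2
    linarith
  have hG12 : 0 < 𝓢.metricInCoords Φ z (Y₁ z) (Y₂ z) := by
    have := (abs_le.1 (happrox _ _ hY₁L hY₂L)).1
    linarith
  set w₁ := mfderiv 𝓘(ℝ, E4) (𝓡 4) Φ z (Y₁ z) with hw₁
  set w₂ := mfderiv 𝓘(ℝ, E4) (𝓡 4) Φ z (Y₂ z) with hw₂
  have ht₁ : 𝓢.metric.IsTimelike w₁ := hG11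
  have ht₂ : 𝓢.metric.IsTimelike w₂ := hG22
  rcases 𝓢.timeOrientation.isFutureDirected_or_isPastDirected_of_isCausal ht₁.isCausal with h₁ | h₁
  · exact hchain Y₁ hY₁ hY₁c h₁
  · -- `Y₁` past at `z`, hence `Y₂` future at `z` (they pair positively)
    have hneg : 𝓢.timeOrientation.IsFutureDirected (-w₁) :=
      (TimeOrientation.isFutureDirected_neg_iff _ _).2 h₁
    have hnegt : 𝓢.metric.IsTimelike (-w₁) := (𝓢.metric.isTimelike_neg_iff _).2 ht₁
    have h₂ : 𝓢.timeOrientation.IsFutureDirected w₂ := by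
      refine (TimeOrientation.isFutureDirected_iff_val_neg _ hneg hnegt ht₂.isCausal).2 ?_
      have : 𝓢.metric.val (Φ z) (-w₁) w₂ = -(𝓢.metricInCoords Φ z (Y₁ z) (Y₂ z)) := by
        rw [map_neg]; rfl
      rw [this]
      linarith
    exact hchain Y₂ hY₂ hY₂c h₂

end Summit.FinalStateConjecture.FinalStateConjecture.Theorems

end
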